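/-
Copyright: statement-level skeleton of a published paper (lit-balaban cell, Phase-2 proof seat p39 gen 17). No proof claims
beyond what the kernel checks below.
-/
import Literature.MathematicalPhysics.QuantumFieldTheory.Balaban1983to89.B3Eq330EtaZeroLattice
import Literature.MathematicalPhysics.QuantumFieldTheory.Balaban1983to89.B3Ineq210ZeroLattice

/-!
# B3 — T. Bałaban, *(Higgs)₂,₃ quantum fields in a finite volume. III. Renormalization*, CMP **88** (1983) 411–445
[Balaban1983Higgs3], p. 437 [PDF 27], **(3.15)–(3.16) ON THE PRINT'S OWN CARRIER**: the vertex coefficient of (3.15) for the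
INFINITE-LATTICE zero-field propagator `G_{j″}(0) = G_{j″}(ηℤ³, 0)` of p. 433 — the assembly (3.15) = (3.16) hypothesis-free on
`ξℤ³`, *"we can estimate (3.16) by a constant"* uniformly in the step `j″` and the window, the p. 437 rescaling sentence
`η`-lattice → `L^{−j″}`-lattice as an identity, the summation over `j, j′ < j″` of (3.15), and the vertex bound `|(3.15)| ≤
Cst·Σ‖φ‖‖q²∂φ′‖`

statement-level skeleton of published theorems with citation tags; proofs where landed; nothing here is a claim about
the Yang–Mills mass gap

PDF held: `paper:balaban1983-higgs-2-3-quantum-fields-finite-volume` (journal page = PDF page + 410); pp. 433–437 [PDF 23–27] read in the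
OCR text (`p0023.txt`–`p0027.txt` of `lit read`); p. 437 checked earlier on the ×2 render
`run/shared/lean/pub/pub-balaban/b2b-balaban-ref1/pages/1983-cmp88-higgs23-III/1983-cmp88-higgs23-III-p027-x2.png` (gens 6, 9 of this seat).

CITATION HEADER (lean-in-tree rule).  Part of the lit-balaban TYPED SKELETON (HOME `run/shared/lean/pub/lit-balaban/`), Phase 2,
proof seat p39 generation 17.  Row **B3.Eq3.11-3.17** of `HOME/lit-balaban-r15/ROWS-B3.md` (fold owner r15), sub-displays (3.15),
(3.16) and the p. 437 sentences around them — the fold owner's named residual of the row after the correction ROWS v1.207 (*"print's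
carrier for (3.4)–(3.38) is the zero-field infinite-lattice scalar propagator G_k(0) = G_k(ηℤ^d,0)"*): *"(3.15) resummation, (3.16)
on ηℤ^{d+1} — p39's ξℤ³ files?"*.  ANSWER GIVEN HERE: the torus readings exist (p20 g2 `B3Bound316` under kernel hypotheses on
r15's torus carrier, p20 g4 `B3Bound316Cxi`, this seat's gen 6 `B3Bound316ZeroTorus`, p20 g6 `B3Eq317ZeroTorus`); this file is
their twin ON THE PRINTED INFINITE LATTICE, built on this seat's gen-9 lattice files BY NAME — `B3Eq316ResolventZeroLattice`
(`GxiL` = `G^ξ_k(0)`, `MxiL` = `G^ξ_k(0) − C^ξ`, the resolvent identity preceding (3.16)), `B3Eq316DifferenceKernelBounds`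
(`prof`, `d2K`, `exists_bounds`: the laws *"|C^ξ| ≦ …, |G^ξ_{j″}(0)| ≦ …, and the corresponding inequalities for derivatives"* with
one rate), `B3Pi2ZeroLattice` (`d2K_add`, `GxiL_eq_conv_add`), gen 8 `B3ZdLatticeProfileSums`/`B3ZdKernelConvolutions` (the Riemann
sums `Σ_{y′}ξ³P₁^δ(y−y′) ≤ 833/δ³`, `tsum_exp_supNorm_le`), gen 11 `B3Eq330EtaZeroLattice` (`GetaL`, `scale330`, `d2K_rescale`:
the `η`-lattice reading), r15's `B3CxiPropagator.sum_pdiffZ_Cxi_pdiffAdjZ` (*"Σ_ν∂^ξ_νC^ξ∂^{ξ*}_ν = −Δ^ξC^ξ = δ^ξ − C^ξ"* on `ℤ^d`)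
and p26 g34's `B3Ineq210ZeroLattice` (`pieceLat`, `sum_pieceLat` = (2.6) for `G_k(0)`, `abs_pieceLat_le` = (2.10) for its pieces).
Nothing of theirs is restated.

THE PRINTED TEXT (p. 437 [PDF 27], verbatim).  *"Let us consider the first expression on the right side of (3.11). The same
expression appears for all orderings of the lines of the graph G₀ with the only condition that they are earlier than the external
lines. Making summations over these orderings and indices means that we sum with respect to j, j′ from 0 to j″, where j″ is the
lowest index of the external lines. After the summations we get
  − Σ_{μ=1}^d Σ_x η^dφ(x)·[Σ_{x′}η^d Σ_{ν=1}^d q(∂^η_νG^η_{j″}(0)∂^{η*}_ν)(x,x′)qg(x)G^η_{j″}(x,x′)g′(x′)(x′_μ − x_μ)](∂^η_μφ′)(x), (3.15)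
and this expression is represented graphically by [picture]. Let us estimate the coefficient in the vertex, i.e. the expression in
the square brackets in (3.15). Rescaling it from the η-lattice to the L^{−j″}-lattice (x, x′ = L^{j″}ηy, L^{j″}ηy′, y, y′ ∈ T_{L^{−j″}})
we get the same expression but with L^{−j″} instead of η. For simplicity let us denote L^{−j″} = ξ. Next we replace G^ξ_{j″}(0) by
C^ξ = (−Δ^ξ + 1)^{−1}: G^ξ_{j″}(0) = C^ξ + G^ξ_{j″}(0)(1 − m²_{j″} − a_{j″}P_{j″})C^ξ. We have Σ_{ν=1}^d ∂^ξ_νC^ξ∂^{ξ*}_ν = −Δ^ξC^ξ =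
δ^ξ − C^ξ and δ^ξ(y′ − y)(y′_μ − y_μ) = 0, so the expression is equal to
  −q²Σ_{y′}ξ^dC^ξ(y−y′)g(y)G^ξ_{j″}(y,y′)g(y′)(y′_μ−y_μ) + q²Σ_{y′}ξ^d(Σ_{ν=1}^d(∂^ξ_νG^ξ_{j″}(0)(1−m²_{j″}−a_{j″}P_{j″})C^ξ∂^{ξ*}_ν)(y,y′))
  ·g(y)G^ξ_{j″}(y,y′)g′(y′)(y′_μ−y_μ). (3.16)
Using the inequalities |C^ξ(y − y′)| ≦ O(1)e^{−½|y−y′|}/|y − y′|, |G^ξ_{j″}(0; y, y′)| ≦ O(1)e^{−δ₀|y−y′|}/|y − y′|, and the corresponding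
inequalities for derivatives, we can estimate (3.16) by a constant. Thus we have finished the analysis of (3.8) and we can summarize
it in the following graphical form [(3.17)]. It is of the required form (3.5)."*  With p. 433: *"Finally we replace the scalar field
propagator G_k(□,0) by G_k(0), i.e. we substitute G_k(□,0) = G_k(0) + δG_k(□,ηZ^d,0) …"* — `G_k(0)` is the propagator of the
infinite lattice `ηℤ^d`, zero external field.

WHAT IS PROVED, and how (`d = 3`; `ℤ³ = ZSite 3` integer labels, spacing `ξ = L^{−k}` = `xiOf ℓ k`, `L = ℓ + 1 ≥ 2`, `k = j″`;
kernels w.r.t. the volume element `Σ ξ³`; `P_q^δ(u) = (ξ·max(1,|u|_∞))^{−q}e^{−δξ|u|_∞}` = `prof ξ δ q u`).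
* §1 THE OBJECTS ON `ℤ³`: the printed displacement `dispZ ξ μ y y′ = ξ(y′_μ − y_μ)`, the kernel `d2diag ξ K = Σ_ν(∂^ξ_νK∂^{ξ*}_ν)`,
  the summands `term315`/`term316` and the series `bracket315L`/`bracket316L` (= r15's torus `bracket315`/`bracket316` with
  `Σ_{y′∈T}` replaced by `Σ'_{y′∈ℤ³}`), and the expression `expr315L` = (3.15) for a leg `φ` supported in a finite set `S`.
* §2 THE (3.16) ASSEMBLY: `term315_eq_term316` (model-free, summand by summand, from the three printed inputs) and, for the
  print's propagator, **`bracket315L_GxiL_eq_bracket316L`** — (3.15) = (3.16) on `ξℤ³` HYPOTHESIS-FREE for `G0 = G^ξ_k(0) = GxiL`,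
  `C = C^ξ`, `M = MxiL`, every second-slot kernel, all localizations: the split is the definition of `M` (the resolvent identity
  `B3Eq316ResolventZeroLattice.hasSum_resolvent316` identifies it with `G(1 − m² − aP)C^ξ`), the lattice equation is r15's
  `sum_pdiffZ_Cxi_pdiffAdjZ`, and `δ^ξ·(y′_μ − y_μ) = 0` is `dispZ_self`.
* §3 MODEL-FREE BOUND: `abs_term316_le` — under `|C| ≤ A·P₁^δ`, `|Σ_ν(∂_νM∂^*_ν)| ≤ B′·P₁^δ`, `|G| ≤ B·P₁^δ`, `|g|,|g′| ≤ 1`,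
  `|dx| ≤ ξ|y−y′|_∞`: `|term316(y,y′)| ≤ (A+B′)·B·ξ³P₁^δ(y−y′)` — THE DISPLACEMENT CANCELS ONE POWER OF THE SINGULARITY
  (`prof_one_mul_dist_le_one`: `P₁^δ(u)·ξ|u|_∞ ≤ 1`); **`abs_bracket316L_le`**: the series converges absolutely and
  `|[(3.16)](y)| ≤ (A+B′)·B·833/δ³` for every `y`, independent of `ξ ≤ 1` (`B3ZdKernelConvolutions.tsum_profile_shift_le`).
* §4 THE PRINT'S PROPAGATOR: **`exists_bracket316L_bound`** — `∃ 0 < δ ≤ 1, Cst > 0` (functions of `L` and the window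
  `[a₋,a₊] × [0,m²₊]`) such that for EVERY `k ≥ 1` and window point `|G^ξ_k(0)| ≤ Cst·P₁^δ` and, for every second slot with
  `|G| ≤ B·P₁^δ`, all `|g|,|g′| ≤ 1`, `μ`, `y`: the (3.16) and (3.15) series converge and are `≤ Cst·B` in absolute value (gen 9's
  `exists_bounds`: `C^ξ`, `(∂_νM∂^*_ν)` at rate `δ/2`, `G^ξ_k(0)`); **`exists_bracket315L_GxiL_bound`** — both slots `G^ξ_k(0)`
  (the zero-field case of the text): `|[(3.15)](y)| ≤ Cst` uniformly in `k`, the window, `μ`, `y`, `g`, `g′`.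
* §5 THE RESCALING SENTENCE: `term315_rescale`/`bracket315L_rescale` (model-free: `η = rξ`, both kernels `↦ r^{−1}·`, the
  `η`-displacement; `η³·r^{−3}·r^{−1}·r = ξ³`, exact in `d = 3`) and **`bracket315L_eta_eq`**: the bracket built on the `η = L^{−k}`
  lattice from gen 11's `G^η_{j″}(0) = GetaL ℓ j″ k` equals the bracket built on the `ξ = L^{−j″}` lattice from `G^ξ_{j″}(0) = GxiL ℓ j″`
  — *"we get the same expression but with L^{−j″} instead of η"*; `exists_bracket315L_eta_bound`: the `η`-lattice vertex coefficient
  is bounded uniformly in `k ≥ j″ ≥ 1`.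
* §6 THE SUMMATION OVER `j, j′ < j″`: `term315_sum_sum`/**`bracket315L_sum_sum`** (bilinearity of (3.15) in its two propagators,
  model-free, under convergence of the piece series), `summable_term315_of_exp` (convergence for exponentially decaying kernels —
  the (2.10) class), `pieceXi`/`sum_pieceXi` (p26's lattice pieces in the `ξ³` normalisation, (2.6): `Σ_{j<k}G^ξ_{(j)}(0) = G^ξ_k(0)`),
  `exists_pieceXi_exp` ((2.10) as an exponential law on `ℤ³`) and **`bracket315L_GxiL_eq_sum_pieces`**: `[(3.15)](G^ξ_k(0), G^ξ_k(0))
  = Σ_{j<k}Σ_{j′<k}[(3.15)](G^ξ_{(j)}(0), G^ξ_{(j′)}(0))`, every `k ≥ 1`, `0 < a`, `0 ≤ m²`.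
* §7 THE VERTEX: `abs_expr315L_le` and **`exists_expr315L_GxiL_bound`** — `|(3.15)| ≤ Cst·Σ_μΣ_{y∈S}ξ³‖φ(y)‖·‖q²D_μ(y)‖` for the
  print's propagator: the resummed term of (3.17) is a local vertex with a bounded coefficient, *"of the required form (3.5)"*.
HONEST SCOPE: `d = 3` (the dimension in which p. 437 writes the singularity `1/|y − y′|`; the model-free §§1–3, 5–6 are written on
`ℤ³` as well); zero external field, unit blocks, `U ≡ 1` — the printed case after the p. 433 reductions; BOTH propagators of (3.15)
instantiated with the zero-field scalar `G^ξ_k(0)` in the hypothesis-free corollaries (the vector-field piece at `A = 0` has the same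
kernel — as in `B3Bound316ZeroTorus`/`B3Eq317ZeroTorus`; the general second slot is kept in `exists_bracket316L_bound`); the summation
*"with respect to j, j′ from 0 to j″"* is taken literally over `[0, j″)²` with `G_{j″}(0) = Σ_{j<j″}G_{(j)}(0)` ((2.6); the
admissibility bookkeeping of orderings, row B3.Eq2.7, is not re-derived — as in p20's `B3Resummation315`); constants existential;
forward lattice differences along the axes.  D-SCOPE PER DISPLAY (the fold owner's question, r15 g13 2026-08-23T00:11:50Z — print's
`d` is 2 or 3): (i) the assembly (3.15) = (3.16) (§2) and the bilinearity/(2.6) resummation (§6) are dimension-free algebra, typed here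
on `ℤ³` only because the carriers (`GxiL`, `pieceLat (d := 2)`) are; (ii) the rescaling sentence: in dimension `d` the `η`-bracket
equals `(L^{j″}η)^{3−d}`× the `ξ`-bracket (`η^d·η^{−2}·η` against `r^{−d}·r^{−d+2}·r`), so *"the same expression"* is EXACT in `d = 3`
(§5) and carries the extra small factor `L^{j″}η ≤ 1` in `d = 2` (degree `−d+3 = 1 > 0`: p. 429 *"In d = 2 graphs are more
convergent"*); (iii) *"we can estimate (3.16) by a constant"*: PROVED here in `d = 3`, the dimension of the displayed laws
`O(1)e^{−½|y−y′|}/|y−y′|`; the `d = 2` twin is THE SAME TEXT with the `d = 2` laws (logarithmic propagator singularity — cf. r15's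
`B3CxiTadpole.Cxi_zero_le_two_log` —, derivative kernels `~ 1/|y−y′|`, two-dimensional Riemann sums `Σξ²(…)`) and the same mechanism
(the displacement cancels one power; every remaining singularity is integrable), i.e. genuinely EASIER, not different; it is NOT
typed here because the lattice-sum toolkit of gens 8–9 (`tsum_profile_le`, `conv22_le`, the `GxiL` laws) is written for `ℤ³`
(unlike the (3.22)/tadpole sentences, where `d = 2` changes the statement — p27 g30 `B3TadpoleZeroTorusTwoDim` —, nothing in
(3.15)–(3.17) changes in `d = 2` beyond the factor in (ii)).  NOT claimed: the picture (3.17) as a graph object (p18/p26 vocabulary), the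
identification of `bracket315L` with the first term of a lattice (3.11) (p26 g34's `B3Ineq313Lattice`, in flight — a one-line
dictionary once it lands), the end-to-end (3.17) identity `Σ(3.9) = (3.15) − Σ(3.12)` on `ℤ³` with (3.13) per piece (needs p26's
lattice (3.9)/(3.12)/(3.13); successor file `B3Eq317ZeroLattice`), `d = 2`, non-zero backgrounds.  Mathlib + the cited tree files
only; definitions with bodies and theorems, no named facts (`… : Prop`); standard axioms (`#print axioms` on
`bracket315L_GxiL_eq_sum_pieces`, `exists_expr315L_GxiL_bound`, `exists_bracket315L_eta_bound`: propext, Classical.choice, Quot.sound).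
Unit `lit-balaban-p39-g17` (Phase-2 proof seat p39, gen 17), HOME `run/shared/lean/pub/lit-balaban/`, 2026-08-23.
-/

open scoped BigOperators RealInnerProductSpace
open Finset

namespace Literature.MathematicalPhysics.QuantumFieldTheory.Balaban1983to89.B3Bound316ZeroLattice

open B3Sect3VectorSelfEnergy (ZSite unitVec pdiffZ pdiffAdjZ Cxi)
open B3CxiUniformBound (supNorm le_supNorm)
open B3CxiPropagator (sum_pdiffZ_Cxi_pdiffAdjZ)
open B3Eq316ResolventZeroLattice (xiOf GxiL MxiL xiOf_pos xiOf_le_one)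
open B3Eq316DifferenceKernelBounds (prof d2K prof_nonneg prof_sub_comm prof_mono_rate exists_bounds)
open B3Pi2ZeroLattice (d2K_add GxiL_eq_conv_add)
open B3ZdKernelConvolutions (tsum_profile_shift_le)
open B3Eq330EtaZeroLattice (scale330 GetaL scale330_pos xiOf_eq_scale_mul GetaL_eq d2K_rescale)
open B3Ineq210ZeroLattice (pieceLat sum_pieceLat abs_pieceLat_le)

noncomputable section

/-! ## §1 The objects of (3.15)/(3.16) on the infinite lattice `ξℤ³` -/

section Defs

variable {W : Type*} [NormedAddCommGroup W] [InnerProductSpace ℝ W]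

/-- the printed displacement `(y′_μ − y_μ)` of (3.15)/(3.16) in physical units on the `ξ`-lattice with integer labels:
`ξ·(y′_μ − y_μ)`. [cite: Balaban1983Higgs3, (3.15) p.437] -/
def dispZ (ξ : ℝ) (μ : Fin 3) (y y' : ZSite 3) : ℝ := ξ * (((y' μ : ℤ) : ℝ) - ((y μ : ℤ) : ℝ))

/-- the kernel `Σ_{ν=1}^{3}(∂^ξ_νK∂^{ξ*}_ν)(y,y′)` of (3.9)/(3.15)/(3.16) (the diagonal mixed second differences of gen 9's `d2K`).
[cite: Balaban1983Higgs3, (3.15) p.437] -/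
def d2diag (ξ : ℝ) (K : ZSite 3 → ZSite 3 → ℝ) (y y' : ZSite 3) : ℝ := ∑ ν : Fin 3, d2K ξ ν ν K y y'

/-- the summand of the square bracket of **(3.15)** p. 437 at `(y, y′)` on `ξℤ³` (volume element `ξ³`):
`ξ³·Σ_ν(∂^ξ_νG^ξ_{j″}(0)∂^{ξ*}_ν)(y,y′)·g(y)G^ξ_{j″}(y,y′)g′(y′)·(y′_μ − y_μ)` (`G0` = `G^ξ_{j″}(0)`, `G` = `G^ξ_{j″}`, `dx μ y y′` =
the displacement). [cite: Balaban1983Higgs3, (3.15) p.437] -/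
def term315 (ξ : ℝ) (G0 G : ZSite 3 → ZSite 3 → ℝ) (g g' : ZSite 3 → ℝ) (dx : Fin 3 → ZSite 3 → ZSite 3 → ℝ)
    (μ : Fin 3) (y y' : ZSite 3) : ℝ :=
  ξ ^ 3 * (d2diag ξ G0 y y' * g y * G y y' * g' y' * dx μ y y')

/-- **THE SQUARE BRACKET OF (3.15) ON THE INFINITE LATTICE** (p. 437 [PDF 27], after the rescaling to the `ξ = L^{−j″}`-lattice),
verbatim: *"[Σ_{x′}η^d Σ_{ν=1}^d q(∂^η_νG^η_{j″}(0)∂^{η*}_ν)(x,x′)qg(x)G^η_{j″}(x,x′)g′(x′)(x′_μ − x_μ)]"* without the charge matrices: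
`Σ'_{y′} ξ³Σ_ν(∂^ξ_νG0∂^{ξ*}_ν)(y,y′)g(y)G(y,y′)g′(y′)dx_μ(y,y′)` — r15's torus `B3Sect3ScalarSelfEnergy.bracket315` with the finite torus sum
replaced by the series over `ℤ³`. [cite: Balaban1983Higgs3, (3.15) p.437] -/
def bracket315L (ξ : ℝ) (G0 G : ZSite 3 → ZSite 3 → ℝ) (g g' : ZSite 3 → ℝ) (dx : Fin 3 → ZSite 3 → ZSite 3 → ℝ)
    (μ : Fin 3) (y : ZSite 3) : ℝ :=
  ∑' y', term315 ξ G0 G g g' dx μ y y'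

/-- the summand of the final expression **(3.16)** p. 437 at `(y, y′)` without `q²`:
`ξ³·[−C^ξ(y−y′) + Σ_ν(∂^ξ_νM∂^{ξ*}_ν)(y,y′)]·g(y)G^ξ_{j″}(y,y′)g′(y′)·(y′_μ − y_μ)` (`C` = the convolution kernel `C^ξ`, `M` = the kernel of
`G^ξ_{j″}(0)(1 − m²_{j″} − a_{j″}P_{j″})C^ξ`). [cite: Balaban1983Higgs3, (3.16) p.437] -/
def term316 (ξ : ℝ) (C : ZSite 3 → ℝ) (M G : ZSite 3 → ZSite 3 → ℝ) (g g' : ZSite 3 → ℝ)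
    (dx : Fin 3 → ZSite 3 → ZSite 3 → ℝ) (μ : Fin 3) (y y' : ZSite 3) : ℝ :=
  ξ ^ 3 * ((-C (y - y') + d2diag ξ M y y') * g y * G y y' * g' y' * dx μ y y')

/-- **THE FINAL EXPRESSION OF (3.16) ON THE INFINITE LATTICE** without `q²`, verbatim: *"so the expression is equal to
−q²Σ_{y′}ξ^dC^ξ(y−y′)g(y)G^ξ_{j″}(y,y′)g(y′)(y′_μ−y_μ) + q²Σ_{y′}ξ^d(Σ_{ν=1}^d(∂^ξ_νG^ξ_{j″}(0)(1−m²_{j″}−a_{j″}P_{j″})C^ξ∂^{ξ*}_ν)(y,y′))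
·g(y)G^ξ_{j″}(y,y′)g′(y′)(y′_μ−y_μ). (3.16)"* — r15's torus `bracket316` with the series over `ℤ³`. [cite: Balaban1983Higgs3, (3.16) p.437] -/
def bracket316L (ξ : ℝ) (C : ZSite 3 → ℝ) (M G : ZSite 3 → ZSite 3 → ℝ) (g g' : ZSite 3 → ℝ)
    (dx : Fin 3 → ZSite 3 → ZSite 3 → ℝ) (μ : Fin 3) (y : ZSite 3) : ℝ :=
  ∑' y', term316 ξ C M G g g' dx μ y y'

/-- **(3.15)** p. 437 [PDF 27] ON THE INFINITE LATTICE, verbatim: *"After the summations we get − Σ_{μ=1}^d Σ_x η^dφ(x)·[Σ_{x′}η^d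
Σ_{ν=1}^d q(∂^η_νG^η_{j″}(0)∂^{η*}_ν)(x,x′)qg(x)G^η_{j″}(x,x′)g′(x′)(x′_μ − x_μ)](∂^η_μφ′)(x), (3.15)"*: `−Σ_μΣ_{y∈S}ξ³φ(y)·[bracket]q²D_μ(y)`
for a localized leg `φ` supported in the finite set `S` (`D μ` = `∂^ξ_μφ′`; the bracket is scalar, `q…q` acts as `q²` on the leg as in
r15's `expr315`). [cite: Balaban1983Higgs3, (3.15) p.437] -/
def expr315L (ξ : ℝ) (q : W →ₗ[ℝ] W) (G0 G : ZSite 3 → ZSite 3 → ℝ) (g g' : ZSite 3 → ℝ)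
    (dx : Fin 3 → ZSite 3 → ZSite 3 → ℝ) (S : Finset (ZSite 3)) (φ : ZSite 3 → W) (D : Fin 3 → ZSite 3 → W) : ℝ :=
  -∑ μ : Fin 3, ∑ y ∈ S, ξ ^ 3 * (bracket315L ξ G0 G g g' dx μ y * ⟪φ y, q (q (D μ y))⟫)

end Defs

/-! ## §2 The assembly (3.15) = (3.16) at the level of the summands (model-free), and for `G_{j″}(0)` -/

section Assembly

variable {ξ : ℝ}

/-- kernel: the displacement vanishes on the diagonal — *"δ^ξ(y′ − y)(y′_μ − y_μ) = 0"*. [cite: Balaban1983Higgs3, (3.16) p.437] -/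
theorem dispZ_self (ξ : ℝ) (μ : Fin 3) (y : ZSite 3) : dispZ ξ μ y y = 0 := by
  simp [dispZ]

/-- kernel: `Σ_ν(∂_νK∂^*_ν)` is additive in the kernel. [cite: Balaban1983Higgs3, (3.16) p.437] -/
theorem d2diag_add (ξ : ℝ) (K K' : ZSite 3 → ZSite 3 → ℝ) (y y' : ZSite 3) :
    d2diag ξ (K + K') y y' = d2diag ξ K y y' + d2diag ξ K' y y' := by
  simp only [d2diag, d2K_add, Finset.sum_add_distrib]

/-- kernel: on a convolution kernel `K(a,b) = C(a − b)`, `Σ_ν(∂_νK∂^*_ν)(y,y′) = Σ_ν(∂^ξ_ν∂^{ξ*}_νC)(y − y′)`.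
[cite: Balaban1983Higgs3, (3.16) p.437] -/
theorem d2diag_conv (ξ : ℝ) (C : ZSite 3 → ℝ) (y y' : ZSite 3) :
    d2diag ξ (fun a b => C (a - b)) y y' = ∑ ν : Fin 3, pdiffZ ξ⁻¹ ν (pdiffAdjZ ξ⁻¹ ν C) (y - y') := by
  simp only [d2diag, B3Eq316DifferenceKernelBounds.d2K_conv]

/-- **THE (3.16) ASSEMBLY, SUMMAND BY SUMMAND** (model-free): if the resummed propagator splits as `G0 = C^ξ + M` (`hG0`; the
resolvent identity preceding (3.16)), the free propagator satisfies *"Σ_{ν=1}^d ∂^ξ_νC^ξ∂^{ξ*}_ν = −Δ^ξC^ξ = δ^ξ − C^ξ"* on `ℤ³`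
(`hC`, `δ^ξ(u) = ξ^{−3}[u = 0]`) and *"δ^ξ(y′ − y)(y′_μ − y_μ) = 0"* (`hdx`), then the (3.15)-summand at `(y,y′)` equals the
(3.16)-summand at `(y,y′)`. [cite: Balaban1983Higgs3, (3.16) p.437] -/
theorem term315_eq_term316 {G0 M G : ZSite 3 → ZSite 3 → ℝ} {C : ZSite 3 → ℝ} {g g' : ZSite 3 → ℝ}
    {dx : Fin 3 → ZSite 3 → ZSite 3 → ℝ} {μ : Fin 3} {y : ZSite 3}
    (hG0 : G0 = (fun a b => C (a - b)) + M)
    (hC : ∀ u : ZSite 3, ∑ ν : Fin 3, pdiffZ ξ⁻¹ ν (pdiffAdjZ ξ⁻¹ ν C) u = (if u = 0 then ξ⁻¹ ^ 3 else 0) - C u)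
    (hdx : dx μ y y = 0) (y' : ZSite 3) :
    term315 ξ G0 G g g' dx μ y y' = term316 ξ C M G g g' dx μ y y' := by
  unfold term315 term316
  rw [hG0, d2diag_add, d2diag_conv, hC]
  by_cases h : y - y' = 0
  · have hy : y' = y := (sub_eq_zero.1 h).symm
    subst hy
    rw [hdx]; ring
  · rw [if_neg h]; ring

/-- **(3.16), THE ASSEMBLY OF ITS FINAL EXPRESSION ON `ξℤ³`** (model-free): under the three printed inputs the square bracket of
(3.15) equals the bracket of (3.16), as series over `ℤ³` (no convergence hypothesis: the summands agree).
[cite: Balaban1983Higgs3, (3.16) p.437] -/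
theorem bracket315L_eq_bracket316L {G0 M G : ZSite 3 → ZSite 3 → ℝ} {C : ZSite 3 → ℝ} {g g' : ZSite 3 → ℝ}
    {dx : Fin 3 → ZSite 3 → ZSite 3 → ℝ} {μ : Fin 3} {y : ZSite 3}
    (hG0 : G0 = (fun a b => C (a - b)) + M)
    (hC : ∀ u : ZSite 3, ∑ ν : Fin 3, pdiffZ ξ⁻¹ ν (pdiffAdjZ ξ⁻¹ ν C) u = (if u = 0 then ξ⁻¹ ^ 3 else 0) - C u)
    (hdx : dx μ y y = 0) :
    bracket315L ξ G0 G g g' dx μ y = bracket316L ξ C M G g g' dx μ y :=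
  tsum_congr fun y' => term315_eq_term316 hG0 hC hdx y'

variable {ℓ k : ℕ} {a m2 : ℝ}

/-- **(3.16) FOR THE PRINT'S PROPAGATOR, HYPOTHESIS-FREE**: for `G^ξ_{j″}(0) = G_{j″}(ξℤ³,0)` (gen 9's `GxiL`, `ξ = L^{−j″}`),
`C^ξ` the momentum-integral free propagator and `M = G^ξ_{j″}(0) − C^ξ = G^ξ_{j″}(0)(1 − m²_{j″} − a_{j″}P_{j″})C^ξ` (`MxiL`, the
resolvent identity `B3Eq316ResolventZeroLattice.hasSum_resolvent316`), the (3.15)-summand equals the (3.16)-summand for every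
second-slot kernel `G`, all localizations and the printed displacement — the three inputs are theorems: the split (definition of
`M`), r15's `sum_pdiffZ_Cxi_pdiffAdjZ` (*"Σ_ν∂^ξ_νC^ξ∂^{ξ*}_ν = δ^ξ − C^ξ"* on `ℤ³`), `dispZ_self`. [cite: Balaban1983Higgs3, (3.16) p.437] -/
theorem term315_GxiL_eq_term316 (G : ZSite 3 → ZSite 3 → ℝ) (g g' : ZSite 3 → ℝ) (μ : Fin 3) (y y' : ZSite 3) :
    term315 (xiOf ℓ k) (GxiL ℓ k a m2) G g g' (dispZ (xiOf ℓ k)) μ y y' =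
      term316 (xiOf ℓ k) (Cxi 3 (xiOf ℓ k)) (MxiL ℓ k a m2) G g g' (dispZ (xiOf ℓ k)) μ y y' :=
  term315_eq_term316 (GxiL_eq_conv_add ℓ k a m2) (fun u => sum_pdiffZ_Cxi_pdiffAdjZ (d := 3) (xiOf_pos ℓ k) u)
    (dispZ_self _ μ y) y'

/-- **(3.15) = (3.16) FOR THE PRINT'S PROPAGATOR ON `ξℤ³`, HYPOTHESIS-FREE** (every `k = j″`, `a`, `m²`, second slot `G`,
localizations `g, g′`, direction `μ`, site `y`). [cite: Balaban1983Higgs3, (3.16) p.437] -/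
theorem bracket315L_GxiL_eq_bracket316L (G : ZSite 3 → ZSite 3 → ℝ) (g g' : ZSite 3 → ℝ) (μ : Fin 3) (y : ZSite 3) :
    bracket315L (xiOf ℓ k) (GxiL ℓ k a m2) G g g' (dispZ (xiOf ℓ k)) μ y =
      bracket316L (xiOf ℓ k) (Cxi 3 (xiOf ℓ k)) (MxiL ℓ k a m2) G g g' (dispZ (xiOf ℓ k)) μ y :=
  tsum_congr fun y' => term315_GxiL_eq_term316 G g g' μ y y'

end Assembly

/-! ## §3 *"We can estimate (3.16) by a constant"* — model-free, from the printed kernel laws -/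

section Bound

variable {ξ δ : ℝ}

/-- kernel: the printed displacement is at most the physical sup distance, `|ξ(y′_μ − y_μ)| ≤ ξ|y − y′|_∞`.
[cite: Balaban1983Higgs3, (3.16) p.437] -/
theorem abs_dispZ_le (hξ : 0 ≤ ξ) (μ : Fin 3) (y y' : ZSite 3) :
    |dispZ ξ μ y y'| ≤ ξ * (supNorm (y - y') : ℝ) := by
  unfold dispZ
  rw [abs_mul, abs_of_nonneg hξ]
  refine mul_le_mul_of_nonneg_left ?_ hξ
  have h1 : |((y' μ : ℤ) : ℝ) - ((y μ : ℤ) : ℝ)| = (((y - y') μ).natAbs : ℝ) := by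
    rw [Pi.sub_apply, Nat.cast_natAbs, Int.cast_abs, Int.cast_sub, abs_sub_comm]
  rw [h1]
  exact_mod_cast le_supNorm (y - y') μ

/-- kernel: THE DISPLACEMENT CANCELS ONE POWER OF THE SINGULARITY — `P₁^δ(u)·ξ|u|_∞ ≤ e^{−δξ|u|_∞} ≤ 1`.
[cite: Balaban1983Higgs3, (3.16) p.437] -/
theorem prof_one_mul_dist_le_one (hξ : 0 < ξ) (hδ : 0 ≤ δ) (u : ZSite 3) :
    prof ξ δ 1 u * (ξ * (supNorm u : ℝ)) ≤ 1 := by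
  unfold prof
  have hn : (0 : ℝ) ≤ (supNorm u : ℝ) := Nat.cast_nonneg _
  have hm : (supNorm u : ℝ) ≤ max 1 (supNorm u : ℝ) := le_max_right _ _
  have hm1 : (1 : ℝ) ≤ max 1 (supNorm u : ℝ) := le_max_left _ _
  have hexp : Real.exp (-(δ * (ξ * (supNorm u : ℝ)))) ≤ 1 :=
    Real.exp_le_one_iff.2 (by nlinarith [mul_nonneg hξ.le hn])
  rw [pow_one]
  calc (ξ * max 1 (supNorm u : ℝ))⁻¹ * Real.exp (-(δ * (ξ * (supNorm u : ℝ)))) * (ξ * (supNorm u : ℝ))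
      = ((supNorm u : ℝ) / max 1 (supNorm u : ℝ)) * Real.exp (-(δ * (ξ * (supNorm u : ℝ)))) := by
        field_simp
    _ ≤ 1 * 1 := by
        refine mul_le_mul ((div_le_one (by positivity)).2 hm) hexp (Real.exp_pos _).le zero_le_one
    _ = 1 := one_mul _

/-- kernel: the profile is positive. [cite: Balaban1983Higgs3, (3.16) p.437] -/
theorem prof_pos (hξ : 0 < ξ) (δ : ℝ) (q : ℕ) (u : ZSite 3) : 0 < prof ξ δ q u := by
  unfold prof
  have : 0 < max 1 (supNorm u : ℝ) := lt_of_lt_of_le zero_lt_one (le_max_left _ _)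
  positivity

/-- **THE SUMMAND OF (3.16) UNDER THE PRINTED LAWS**: with one rate `δ` for *"|C^ξ(y − y′)| ≦ O(1)e^{−½|y−y′|}/|y − y′|,
|G^ξ_{j″}(0; y, y′)| ≦ O(1)e^{−δ₀|y−y′|}/|y − y′|, and the corresponding inequalities for derivatives"* — `|C(u)| ≤ A·P₁^δ(u)`,
`|Σ_ν(∂_νM∂^*_ν)(y,y′)| ≤ B′·P₁^δ(y−y′)`, `|G(y,y′)| ≤ B·P₁^δ(y−y′)` —, `|g|, |g′| ≤ 1` and `|dx_μ(y,y′)| ≤ ξ|y−y′|_∞`: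
`|term316(y,y′)| ≤ (A + B′)·B·ξ³P₁^δ(y − y′)` (the displacement eats the second inverse power). [cite: Balaban1983Higgs3, (3.16) p.437] -/
theorem abs_term316_le {C : ZSite 3 → ℝ} {M G : ZSite 3 → ZSite 3 → ℝ} {g g' : ZSite 3 → ℝ}
    {dx : Fin 3 → ZSite 3 → ZSite 3 → ℝ} {μ : Fin 3} {A B B' : ℝ} (hξ : 0 < ξ) (hδ : 0 ≤ δ)
    (hC : ∀ u, |C u| ≤ A * prof ξ δ 1 u) (hM : ∀ y y', |d2diag ξ M y y'| ≤ B' * prof ξ δ 1 (y - y'))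
    (hG : ∀ y y', |G y y'| ≤ B * prof ξ δ 1 (y - y')) (hg : ∀ x, |g x| ≤ 1) (hg' : ∀ x, |g' x| ≤ 1)
    (hdx : ∀ y y', |dx μ y y'| ≤ ξ * (supNorm (y - y') : ℝ)) (y y' : ZSite 3) :
    |term316 ξ C M G g g' dx μ y y'| ≤ (A + B') * B * (ξ ^ 3 * prof ξ δ 1 (y - y')) := by
  set P := prof ξ δ 1 (y - y') with hPdef
  have hP : 0 < P := prof_pos hξ δ 1 _
  have hX : |-C (y - y') + d2diag ξ M y y'| ≤ (A + B') * P := by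
    calc |-C (y - y') + d2diag ξ M y y'| ≤ |-C (y - y')| + |d2diag ξ M y y'| := abs_add_le _ _
      _ ≤ A * P + B' * P := by rw [abs_neg]; exact add_le_add (hC _) (hM _ _)
      _ = (A + B') * P := by ring
  have hABP : 0 ≤ (A + B') * P := (abs_nonneg _).trans hX
  have hBP : 0 ≤ B * P := (abs_nonneg _).trans (hG y y')
  have hn : 0 ≤ ξ * (supNorm (y - y') : ℝ) := by positivity
  have hAB : 0 ≤ A + B' := le_of_mul_le_mul_right (by rwa [zero_mul]) hP
  have hB : 0 ≤ B := le_of_mul_le_mul_right (by rwa [zero_mul]) hP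
  -- the product of the five factors
  have h12 : |-C (y - y') + d2diag ξ M y y'| * |g y| ≤ (A + B') * P * 1 :=
    mul_le_mul hX (hg y) (abs_nonneg _) hABP
  have h123 : |-C (y - y') + d2diag ξ M y y'| * |g y| * |G y y'| ≤ (A + B') * P * 1 * (B * P) :=
    mul_le_mul h12 (hG y y') (abs_nonneg _) (by rw [mul_one]; exact hABP)
  have h1234 : |-C (y - y') + d2diag ξ M y y'| * |g y| * |G y y'| * |g' y'| ≤ (A + B') * P * 1 * (B * P) * 1 :=
    mul_le_mul h123 (hg' y') (abs_nonneg _) (by rw [mul_one]; exact mul_nonneg hABP hBP)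
  have h12345 : |-C (y - y') + d2diag ξ M y y'| * |g y| * |G y y'| * |g' y'| * |dx μ y y'| ≤
      (A + B') * P * 1 * (B * P) * 1 * (ξ * (supNorm (y - y') : ℝ)) :=
    mul_le_mul h1234 (hdx y y') (abs_nonneg _) (by rw [mul_one, mul_one]; exact mul_nonneg hABP hBP)
  have hkey : P * (ξ * (supNorm (y - y') : ℝ)) ≤ 1 := prof_one_mul_dist_le_one hξ hδ (y - y')
  unfold term316
  rw [abs_mul, abs_of_pos (pow_pos hξ 3), abs_mul, abs_mul, abs_mul, abs_mul]
  calc ξ ^ 3 * (|-C (y - y') + d2diag ξ M y y'| * |g y| * |G y y'| * |g' y'| * |dx μ y y'|)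
      ≤ ξ ^ 3 * ((A + B') * P * 1 * (B * P) * 1 * (ξ * (supNorm (y - y') : ℝ))) :=
        mul_le_mul_of_nonneg_left h12345 (pow_pos hξ 3).le
    _ = (A + B') * B * (ξ ^ 3 * P) * (P * (ξ * (supNorm (y - y') : ℝ))) := by ring
    _ ≤ (A + B') * B * (ξ ^ 3 * P) * 1 :=
        mul_le_mul_of_nonneg_left hkey (mul_nonneg (mul_nonneg hAB hB) (by positivity))
    _ = (A + B') * B * (ξ ^ 3 * P) := mul_one _

/-- **"WE CAN ESTIMATE (3.16) BY A CONSTANT" ON THE INFINITE LATTICE** (model-free form): under the printed kernel laws with one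
rate `0 < δ ≤ 1` and `0 < ξ ≤ 1`, the series (3.16) converges absolutely and `|[(3.16)](y)| ≤ (A + B′)·B·833/δ³` for EVERY `y`
— a constant independent of the spacing `ξ` (the Riemann sums `Σ_{y′}ξ³P₁^δ(y − y′) ≤ 833/δ³` of gen 8's `tsum_profile_le`).
[cite: Balaban1983Higgs3, (3.16) p.437] -/
theorem abs_bracket316L_le {C : ZSite 3 → ℝ} {M G : ZSite 3 → ZSite 3 → ℝ} {g g' : ZSite 3 → ℝ}
    {dx : Fin 3 → ZSite 3 → ZSite 3 → ℝ} {μ : Fin 3} {A B B' : ℝ} (hξ : 0 < ξ) (hξ1 : ξ ≤ 1) (hδ : 0 < δ) (hδ1 : δ ≤ 1)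
    (hC : ∀ u, |C u| ≤ A * prof ξ δ 1 u) (hM : ∀ y y', |d2diag ξ M y y'| ≤ B' * prof ξ δ 1 (y - y'))
    (hG : ∀ y y', |G y y'| ≤ B * prof ξ δ 1 (y - y')) (hg : ∀ x, |g x| ≤ 1) (hg' : ∀ x, |g' x| ≤ 1)
    (hdx : ∀ y y', |dx μ y y'| ≤ ξ * (supNorm (y - y') : ℝ)) (y : ZSite 3) :
    Summable (term316 ξ C M G g g' dx μ y) ∧
      |bracket316L ξ C M G g g' dx μ y| ≤ (A + B') * B * (833 / δ ^ 3) := by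
  obtain ⟨⟨hs, hle⟩, -⟩ := tsum_profile_shift_le hξ hξ1 hδ hδ1 (le_refl 1 |>.trans one_le_two) y y
  have hpt : ∀ y', |term316 ξ C M G g g' dx μ y y'| ≤
      (A + B') * B * (ξ ^ 3 * prof ξ δ 1 (y - y')) := fun y' =>
    abs_term316_le hξ hδ.le hC hM hG hg hg' hdx y y'
  have hs' : Summable fun y' => (A + B') * B * (ξ ^ 3 * prof ξ δ 1 (y - y')) := hs.mul_left _
  have hsum : Summable (term316 ξ C M G g g' dx μ y) :=
    Summable.of_norm_bounded hs' (fun y' => (Real.norm_eq_abs _).le.trans (hpt y'))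
  refine ⟨hsum, ?_⟩
  have hP : 0 < prof ξ δ 1 (y - y) := prof_pos hξ δ 1 _
  have hABB : 0 ≤ (A + B') * B := by
    have h0 := (abs_nonneg _).trans (hpt y)
    exact le_of_mul_le_mul_right (by rwa [zero_mul]) (by positivity : 0 < ξ ^ 3 * prof ξ δ 1 (y - y))
  calc |bracket316L ξ C M G g g' dx μ y| = |∑' y', term316 ξ C M G g g' dx μ y y'| := rfl
    _ ≤ ∑' y', (A + B') * B * (ξ ^ 3 * prof ξ δ 1 (y - y')) :=
        B3Eq316DifferenceKernelBounds.abs_tsum_le_tsum_of_abs_le hsum hs' hpt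
    _ = (A + B') * B * ∑' y', ξ ^ 3 * prof ξ δ 1 (y - y') := tsum_mul_left
    _ ≤ (A + B') * B * (833 / δ ^ 3) := mul_le_mul_of_nonneg_left hle hABB

/-- kernel: the same hypotheses bound the (3.15)-series whenever its summands are those of (3.16). [cite: Balaban1983Higgs3, (3.16) p.437] -/
theorem abs_bracket315L_le_of_eq {G0 M G : ZSite 3 → ZSite 3 → ℝ} {C : ZSite 3 → ℝ} {g g' : ZSite 3 → ℝ}
    {dx : Fin 3 → ZSite 3 → ZSite 3 → ℝ} {μ : Fin 3} {A B B' : ℝ} (hξ : 0 < ξ) (hξ1 : ξ ≤ 1) (hδ : 0 < δ) (hδ1 : δ ≤ 1)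
    (hC : ∀ u, |C u| ≤ A * prof ξ δ 1 u) (hM : ∀ y y', |d2diag ξ M y y'| ≤ B' * prof ξ δ 1 (y - y'))
    (hG : ∀ y y', |G y y'| ≤ B * prof ξ δ 1 (y - y')) (hg : ∀ x, |g x| ≤ 1) (hg' : ∀ x, |g' x| ≤ 1)
    (hdx : ∀ y y', |dx μ y y'| ≤ ξ * (supNorm (y - y') : ℝ)) (y : ZSite 3)
    (heq : ∀ y', term315 ξ G0 G g g' dx μ y y' = term316 ξ C M G g g' dx μ y y') :
    Summable (term315 ξ G0 G g g' dx μ y) ∧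
      |bracket315L ξ G0 G g g' dx μ y| ≤ (A + B') * B * (833 / δ ^ 3) := by
  obtain ⟨hs, hle⟩ := abs_bracket316L_le hξ hξ1 hδ hδ1 hC hM hG hg hg' hdx y
  have e : term315 ξ G0 G g g' dx μ y = term316 ξ C M G g g' dx μ y := funext heq
  refine ⟨e ▸ hs, ?_⟩
  rw [bracket315L, e]
  exact hle

end Bound

/-! ## §4 The print's propagator: *"we can estimate (3.16) by a constant"* for `G_{j″}(0) = G_{j″}(ξℤ³, 0)`, hypothesis-free -/

section Instance

variable {ℓ : ℕ}

/-- kernel: `|Σ_ν(∂_νM∂^*_ν)(y,y′)| ≤ 3K·P` from the per-direction bound `|(∂_νM∂^*_ν)(y,y′)| ≤ K·P`.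
[cite: Balaban1983Higgs3, (3.16) p.437] -/
theorem abs_d2diag_le_of_forall {ξ : ℝ} {M : ZSite 3 → ZSite 3 → ℝ} {F : ZSite 3 → ZSite 3 → ℝ}
    (h : ∀ (ν : Fin 3) (y y' : ZSite 3), |d2K ξ ν ν M y y'| ≤ F y y') (y y' : ZSite 3) :
    |d2diag ξ M y y'| ≤ 3 * F y y' := by
  unfold d2diag
  calc |∑ ν : Fin 3, d2K ξ ν ν M y y'| ≤ ∑ ν : Fin 3, |d2K ξ ν ν M y y'| := Finset.abs_sum_le_sum_abs _ _
    _ ≤ ∑ _ν : Fin 3, F y y' := Finset.sum_le_sum fun ν _ => h ν y y'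
    _ = 3 * F y y' := by simp

/-- **"USING THE INEQUALITIES |C^ξ(y − y′)| ≦ O(1)e^{−½|y−y′|}/|y − y′|, |G^ξ_{j″}(0; y, y′)| ≦ O(1)e^{−δ₀|y−y′|}/|y − y′|, AND THE
CORRESPONDING INEQUALITIES FOR DERIVATIVES, WE CAN ESTIMATE (3.16) BY A CONSTANT" — PROVED ON THE PRINT'S CARRIER `ξℤ³`** for the
infinite-lattice zero-field propagator `G^ξ_{j″}(0) = G_{j″}(ξℤ³,0)` (gen 9's `GxiL ℓ k`, `k = j″`, `ξ = L^{−k}`), its free part `C^ξ`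
and `M = G^ξ_{j″}(0) − C^ξ`: there are `0 < δ ≤ 1` and `Cst > 0`, functions of `L` and the window `[a₋,a₊] × [0,m²₊]` only, such that
for EVERY `k ≥ 1` and window point (i) `|G^ξ_k(0;y,y′)| ≤ Cst·P₁^δ(y−y′)` (so the second slot may be `G^ξ_k(0)` itself with `B = Cst`),
and (ii) for every second-slot kernel with `|G(y,y′)| ≤ B·P₁^δ(y−y′)`, all localizations `|g|, |g′| ≤ 1`, every `μ` and `y`: the
series (3.16) and (3.15) converge absolutely and `|[(3.16)](y)| ≤ Cst·B`, `|[(3.15)](y)| ≤ Cst·B` — uniformly in `k`, the window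
and `y`.  The kernel laws are gen 9's `B3Eq316DifferenceKernelBounds.exists_bounds` (`|C^ξ| ≤ C·P₁^δ`, `|(∂_νM∂^*_ν)| ≤ K·P₁^{δ/2}`,
`|G^ξ_k(0)| ≤ C·P₁^δ`); (3.15) = (3.16) by `bracket315L_GxiL_eq_bracket316L`. [cite: Balaban1983Higgs3, (3.16) p.437] -/
theorem exists_bracket316L_bound (hℓ : 1 ≤ ℓ) (amin aplus m2plus : ℝ) (ha : 0 < amin) :
    ∃ δ Cst : ℝ, 0 < δ ∧ δ ≤ 1 ∧ 0 < Cst ∧ ∀ (k : ℕ), 1 ≤ k → ∀ (a m2 : ℝ), amin ≤ a → a ≤ aplus → 0 ≤ m2 →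
      m2 ≤ m2plus →
      (∀ y y' : ZSite 3, |GxiL ℓ k a m2 y y'| ≤ Cst * prof (xiOf ℓ k) δ 1 (y - y')) ∧
      ∀ (G : ZSite 3 → ZSite 3 → ℝ) (B : ℝ), (∀ y y', |G y y'| ≤ B * prof (xiOf ℓ k) δ 1 (y - y')) →
        ∀ (g g' : ZSite 3 → ℝ), (∀ x, |g x| ≤ 1) → (∀ x, |g' x| ≤ 1) → ∀ (μ : Fin 3) (y : ZSite 3),
          (Summable (term316 (xiOf ℓ k) (Cxi 3 (xiOf ℓ k)) (MxiL ℓ k a m2) G g g' (dispZ (xiOf ℓ k)) μ y) ∧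
            |bracket316L (xiOf ℓ k) (Cxi 3 (xiOf ℓ k)) (MxiL ℓ k a m2) G g g' (dispZ (xiOf ℓ k)) μ y| ≤ Cst * B) ∧
          (Summable (term315 (xiOf ℓ k) (GxiL ℓ k a m2) G g g' (dispZ (xiOf ℓ k)) μ y) ∧
            |bracket315L (xiOf ℓ k) (GxiL ℓ k a m2) G g g' (dispZ (xiOf ℓ k)) μ y| ≤ Cst * B) := by
  obtain ⟨δ, C, K, hδ, hδh, hC1, hK, hB⟩ := exists_bounds hℓ amin aplus m2plus ha
  have hC0 : 0 ≤ C := le_trans (by norm_num) hC1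
  have hδh0 : 0 < δ / 2 := by linarith
  have hδh1 : δ / 2 ≤ 1 := by linarith
  set Cst : ℝ := (C + 3 * K) * (833 / (δ / 2) ^ 3) with hCst
  have h833 : (1 : ℝ) ≤ 833 / (δ / 2) ^ 3 := by
    rw [le_div_iff₀ (by positivity)]
    have : (δ / 2) ^ 3 ≤ 1 := pow_le_one₀ hδh0.le hδh1
    linarith
  have hCle : C ≤ Cst := by
    rw [hCst]
    calc C = C * 1 := (mul_one C).symm
      _ ≤ (C + 3 * K) * (833 / (δ / 2) ^ 3) := mul_le_mul (by linarith [hK.le]) h833 zero_le_one (by positivity)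
  refine ⟨δ / 2, Cst, hδh0, hδh1, by positivity, ?_⟩
  intro k hk a m2 ha1 ha2 hm1 hm2
  obtain ⟨⟨l1, -, -, -, -, -, l7, -, -⟩, -, bd2, -⟩ := hB k hk a m2 ha1 ha2 hm1 hm2
  have hξ := xiOf_pos ℓ k
  have hξ1 := xiOf_le_one ℓ k
  -- the laws at the common rate `δ/2`
  have lG : ∀ y y' : ZSite 3, |GxiL ℓ k a m2 y y'| ≤ Cst * prof (xiOf ℓ k) (δ / 2) 1 (y - y') := fun y y' =>
    (l1 y y').trans (mul_le_mul hCle (prof_mono_rate hξ.le (by linarith) 1 _) (prof_nonneg hξ.le _ _ _)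
      (hC0.trans hCle))
  have lC : ∀ u : ZSite 3, |Cxi 3 (xiOf ℓ k) u| ≤ C * prof (xiOf ℓ k) (δ / 2) 1 u := fun u =>
    (l7 u).trans (mul_le_mul_of_nonneg_left (prof_mono_rate hξ.le (by linarith) 1 _) hC0)
  have lM : ∀ y y' : ZSite 3, |d2diag (xiOf ℓ k) (MxiL ℓ k a m2) y y'| ≤
      3 * K * prof (xiOf ℓ k) (δ / 2) 1 (y - y') := fun y y' =>
    (abs_d2diag_le_of_forall (F := fun y y' => K * prof (xiOf ℓ k) (δ / 2) 1 (y - y'))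
      (fun ν y y' => bd2 ν ν y y') y y').trans_eq (by ring)
  refine ⟨lG, ?_⟩
  intro G B hG g g' hg hg' μ y
  have hdx : ∀ y y' : ZSite 3, |dispZ (xiOf ℓ k) μ y y'| ≤ xiOf ℓ k * (supNorm (y - y') : ℝ) :=
    fun y y' => abs_dispZ_le hξ.le μ y y'
  have e : (C + 3 * K) * B * (833 / (δ / 2) ^ 3) = Cst * B := by rw [hCst]; ring
  refine ⟨?_, ?_⟩
  · obtain ⟨hs, hle⟩ := abs_bracket316L_le hξ hξ1 hδh0 hδh1 lC lM hG hg hg' hdx y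
    exact ⟨hs, hle.trans_eq e⟩
  · obtain ⟨hs, hle⟩ := abs_bracket315L_le_of_eq hξ hξ1 hδh0 hδh1 lC lM hG hg hg' hdx y
      (fun y' => term315_GxiL_eq_term316 G g g' μ y y')
    exact ⟨hs, hle.trans_eq e⟩

/-- **THE VERTEX COEFFICIENT OF (3.15) IS BOUNDED BY A CONSTANT ON THE PRINT'S CARRIER** — the case of the text, both propagators
of (3.15) equal to the zero-field `G^ξ_{j″}(0)` (p. 437: *"we can estimate (3.16) by a constant"*; at zero field the vector-field
piece has the same kernel): `∃ Cst ∀ k = j″ ≥ 1 ∀ window ∀ |g|,|g′| ≤ 1 ∀ μ y`, the series converges absolutely and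
`|[(3.15)](y)| ≤ Cst`. [cite: Balaban1983Higgs3, (3.16) p.437] -/
theorem exists_bracket315L_GxiL_bound (hℓ : 1 ≤ ℓ) (amin aplus m2plus : ℝ) (ha : 0 < amin) :
    ∃ Cst : ℝ, 0 < Cst ∧ ∀ (k : ℕ), 1 ≤ k → ∀ (a m2 : ℝ), amin ≤ a → a ≤ aplus → 0 ≤ m2 → m2 ≤ m2plus →
      ∀ (g g' : ZSite 3 → ℝ), (∀ x, |g x| ≤ 1) → (∀ x, |g' x| ≤ 1) → ∀ (μ : Fin 3) (y : ZSite 3),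
        Summable (term315 (xiOf ℓ k) (GxiL ℓ k a m2) (GxiL ℓ k a m2) g g' (dispZ (xiOf ℓ k)) μ y) ∧
          |bracket315L (xiOf ℓ k) (GxiL ℓ k a m2) (GxiL ℓ k a m2) g g' (dispZ (xiOf ℓ k)) μ y| ≤ Cst := by
  obtain ⟨δ, Cst, hδ, hδ1, hCst, h⟩ := exists_bracket316L_bound hℓ amin aplus m2plus ha
  refine ⟨Cst * Cst, by positivity, ?_⟩
  intro k hk a m2 ha1 ha2 hm1 hm2 g g' hg hg' μ y
  obtain ⟨lG, hh⟩ := h k hk a m2 ha1 ha2 hm1 hm2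
  exact (hh (GxiL ℓ k a m2) Cst lG g g' hg hg' μ y).2

end Instance

/-! ## §5 The p. 437 rescaling sentence: from the `η`-lattice to the `L^{−j″}`-lattice -/

section Rescale

/-- kernel: `Σ_ν(∂K∂^*)` rescales by `r^{−3}`: `d2diag (rξ) (r⁻¹K) = r⁻³·d2diag ξ K`. [cite: Balaban1983Higgs3, (3.16) p.437] -/
theorem d2diag_rescale (r ξ : ℝ) (K : ZSite 3 → ZSite 3 → ℝ) (y y' : ZSite 3) :
    d2diag (r * ξ) (fun p q => r⁻¹ * K p q) y y' = r⁻¹ ^ 3 * d2diag ξ K y y' := by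
  simp only [d2diag, d2K_rescale ξ K r, Finset.mul_sum]

/-- kernel: the displacement rescales by `r`: `(x′_μ − x_μ)_η = r·(y′_μ − y_μ)_ξ` on the same labels (`η = rξ`).
[cite: Balaban1983Higgs3, (3.16) p.437] -/
theorem dispZ_rescale (r ξ : ℝ) (μ : Fin 3) (y y' : ZSite 3) :
    dispZ (r * ξ) μ y y' = r * dispZ ξ μ y y' := by
  unfold dispZ; ring

/-- **p. 437, THE RESCALING SENTENCE, MODEL-FREE ON `ℤ³`** (`d = 3`): *"Rescaling it from the η-lattice to the L^{−j″}-lattice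
(x, x′ = L^{j″}ηy, L^{j″}ηy′, y, y′ ∈ T_{L^{−j″}}) we get the same expression but with L^{−j″} instead of η"* — with `η = rξ`
and both propagators rescaled by `r^{−d+2} = r^{−1}`, the (3.15)-summand on the `η`-lattice EQUALS the (3.15)-summand on the
`ξ`-lattice at the same integer labels (`η³·r⁻³·r⁻¹·r = ξ³`, exact in `d = 3`). [cite: Balaban1983Higgs3, (3.16) p.437] -/
theorem term315_rescale {r : ℝ} (hr : r ≠ 0) (ξ : ℝ) (K G : ZSite 3 → ZSite 3 → ℝ) (g g' : ZSite 3 → ℝ) (μ : Fin 3)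
    (y y' : ZSite 3) :
    term315 (r * ξ) (fun p q => r⁻¹ * K p q) (fun p q => r⁻¹ * G p q) g g' (dispZ (r * ξ)) μ y y' =
      term315 ξ K G g g' (dispZ ξ) μ y y' := by
  simp only [term315, d2diag_rescale, dispZ_rescale, mul_pow, inv_pow]
  field_simp

/-- kernel: hence the square brackets agree as series. [cite: Balaban1983Higgs3, (3.16) p.437] -/
theorem bracket315L_rescale {r : ℝ} (hr : r ≠ 0) (ξ : ℝ) (K G : ZSite 3 → ZSite 3 → ℝ) (g g' : ZSite 3 → ℝ)
    (μ : Fin 3) (y : ZSite 3) :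
    bracket315L (r * ξ) (fun p q => r⁻¹ * K p q) (fun p q => r⁻¹ * G p q) g g' (dispZ (r * ξ)) μ y =
      bracket315L ξ K G g g' (dispZ ξ) μ y :=
  tsum_congr fun y' => term315_rescale hr ξ K G g g' μ y y'

/-- **p. 437, THE RESCALING SENTENCE FOR THE PRINT'S PROPAGATOR**: the square bracket of (3.15) built ON THE `η`-LATTICE
(`η = L^{−k}`) from the `η`-lattice propagator `G^η_{j″}(0)` of the `j″`-th step (gen 11's `GetaL ℓ j k`, `j = j″ ≤ k`; second slot
`(L^{j″}η)^{−1}G` = the `η`-lattice reading of a `ξ`-lattice kernel `G`) with the `η`-displacement EQUALS the square bracket built on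
the `ξ = L^{−j″}`-lattice from `G^ξ_{j″}(0)` (gen 9's `GxiL ℓ j`) — *"we get the same expression but with L^{−j″} instead of η"*,
an exact identity in `d = 3` for all localizations, `μ` and labels `y`. [cite: Balaban1983Higgs3, (3.16) p.437] -/
theorem bracket315L_eta_eq (ℓ j k : ℕ) (a m2 : ℝ) (G : ZSite 3 → ZSite 3 → ℝ) (g g' : ZSite 3 → ℝ) (μ : Fin 3)
    (y : ZSite 3) :
    bracket315L (xiOf ℓ k) (GetaL ℓ j k a m2) (fun p q => (scale330 ℓ j k)⁻¹ * G p q) g g' (dispZ (xiOf ℓ k)) μ y =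
      bracket315L (xiOf ℓ j) (GxiL ℓ j a m2) G g g' (dispZ (xiOf ℓ j)) μ y := by
  rw [GetaL_eq ℓ j k a m2, xiOf_eq_scale_mul ℓ j k]
  exact bracket315L_rescale (scale330_pos ℓ j k).ne' _ _ _ _ _ _ _

/-- **THE VERTEX COEFFICIENT OF (3.15) ON THE `η`-LATTICE IS BOUNDED, UNIFORMLY IN `η`**: for the `η`-lattice propagator
`G^η_{j″}(0)` in both slots (`η = L^{−k}`, any `k ≥ j″ ≥ 1`), all localizations `|g|,|g′| ≤ 1`, every `μ` and `x`:
`|[(3.15) on the η-lattice](x)| ≤ Cst` with the constant of `exists_bracket315L_GxiL_bound` (rescaling sentence + the `ξ`-lattice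
bound). [cite: Balaban1983Higgs3, (3.16) p.437] -/
theorem exists_bracket315L_eta_bound {ℓ : ℕ} (hℓ : 1 ≤ ℓ) (amin aplus m2plus : ℝ) (ha : 0 < amin) :
    ∃ Cst : ℝ, 0 < Cst ∧ ∀ (j k : ℕ), 1 ≤ j → ∀ (a m2 : ℝ), amin ≤ a → a ≤ aplus → 0 ≤ m2 → m2 ≤ m2plus →
      ∀ (g g' : ZSite 3 → ℝ), (∀ x, |g x| ≤ 1) → (∀ x, |g' x| ≤ 1) → ∀ (μ : Fin 3) (x : ZSite 3),
        |bracket315L (xiOf ℓ k) (GetaL ℓ j k a m2) (GetaL ℓ j k a m2) g g' (dispZ (xiOf ℓ k)) μ x| ≤ Cst := by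
  obtain ⟨Cst, hCst, h⟩ := exists_bracket315L_GxiL_bound hℓ amin aplus m2plus ha
  refine ⟨Cst, hCst, ?_⟩
  intro j k hj a m2 ha1 ha2 hm1 hm2 g g' hg hg' μ x
  have e := bracket315L_eta_eq ℓ j k a m2 (GxiL ℓ j a m2) g g' μ x
  rw [← GetaL_eq ℓ j k a m2] at e
  rw [e]
  exact (h j hj a m2 ha1 ha2 hm1 hm2 g g' hg hg' μ x).2

end Rescale

/-! ## §6 The summation over `j, j′ < j″` of (3.15): bilinearity, and (2.6) for `G_{j″}(0)` -/

section Resummation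

variable {ι ι' : Type*}

/-- kernel: `Σ_ν(∂K∂^*_ν)` of a finite sum of kernels. [cite: Balaban1983Higgs3, (3.15) p.437] -/
theorem d2diag_finset_sum (s : Finset ι) (K : ι → ZSite 3 → ZSite 3 → ℝ) (ξ : ℝ) (y y' : ZSite 3) :
    d2diag ξ (∑ i ∈ s, K i) y y' = ∑ i ∈ s, d2diag ξ (K i) y y' := by
  classical
  induction s using Finset.induction_on with
  | empty => simp [d2diag, d2K]
  | insert i s hi ih => rw [Finset.sum_insert hi, Finset.sum_insert hi, d2diag_add, ih]

/-- **(3.15) IS BILINEAR IN ITS TWO PROPAGATORS, SUMMAND BY SUMMAND**: for finite families of kernels the (3.15)-summand of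
`(Σ_i K_i, Σ_{i′} K′_{i′})` is the double sum of the summands — the content of *"The same expression appears for all orderings of
the lines of the graph G₀ … Making summations over these orderings and indices means that we sum with respect to j, j′"* at the
level of the integrand. [cite: Balaban1983Higgs3, (3.15) p.437] -/
theorem term315_sum_sum (s : Finset ι) (t : Finset ι') (K : ι → ZSite 3 → ZSite 3 → ℝ)
    (K' : ι' → ZSite 3 → ZSite 3 → ℝ) (ξ : ℝ) (g g' : ZSite 3 → ℝ) (dx : Fin 3 → ZSite 3 → ZSite 3 → ℝ) (μ : Fin 3)
    (y y' : ZSite 3) :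
    term315 ξ (∑ i ∈ s, K i) (∑ i' ∈ t, K' i') g g' dx μ y y' =
      ∑ i ∈ s, ∑ i' ∈ t, term315 ξ (K i) (K' i') g g' dx μ y y' := by
  simp only [term315, d2diag_finset_sum, Finset.sum_apply, Finset.sum_mul, Finset.mul_sum]
  exact Finset.sum_comm

/-- **"MAKING SUMMATIONS OVER THESE ORDERINGS AND INDICES MEANS THAT WE SUM WITH RESPECT TO j, j′ FROM 0 TO j″ … AFTER THE
SUMMATIONS WE GET (3.15)"** — model-free on `ℤ³`: if every `(i, i′)` series converges, the square bracket of (3.15) for the summed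
propagators `(Σ_i K_i, Σ_{i′} K′_{i′})` is the double sum of the brackets of the pieces. [cite: Balaban1983Higgs3, (3.15) p.437] -/
theorem bracket315L_sum_sum (s : Finset ι) (t : Finset ι') (K : ι → ZSite 3 → ZSite 3 → ℝ)
    (K' : ι' → ZSite 3 → ZSite 3 → ℝ) (ξ : ℝ) (g g' : ZSite 3 → ℝ) (dx : Fin 3 → ZSite 3 → ZSite 3 → ℝ) (μ : Fin 3)
    (y : ZSite 3) (hs : ∀ i ∈ s, ∀ i' ∈ t, Summable (term315 ξ (K i) (K' i') g g' dx μ y)) :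
    bracket315L ξ (∑ i ∈ s, K i) (∑ i' ∈ t, K' i') g g' dx μ y =
      ∑ i ∈ s, ∑ i' ∈ t, bracket315L ξ (K i) (K' i') g g' dx μ y := by
  simp only [bracket315L, term315_sum_sum]
  rw [Summable.tsum_finsetSum (fun i hi => summable_sum fun i' hi' => hs i hi i' hi')]
  exact Finset.sum_congr rfl fun i hi => Summable.tsum_finsetSum fun i' hi' => hs i hi i' hi'

/-! ### Summability of the (3.15)-series for exponentially decaying kernels -/

/-- kernel: `|u|_∞ ≤ |u ± e_ν|_∞ + 1`. [cite: Balaban1983Higgs3, (3.15) p.437] -/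
theorem supNorm_le_shift_add_one (u : ZSite 3) (ν : Fin 3) :
    (supNorm u : ℝ) ≤ (supNorm (u + unitVec ν) : ℝ) + 1 ∧ (supNorm u : ℝ) ≤ (supNorm (u - unitVec ν) : ℝ) + 1 := by
  obtain ⟨h1, h2⟩ := B3CxiLatticePairSums.supNorm_unitVec ν
  constructor
  · have h := B3ZdLatticeProfileSums.supNorm_le_add_sub u (u + unitVec ν)
    rw [show u - (u + unitVec ν) = -unitVec ν by abel, h2] at h
    exact_mod_cast h
  · have h := B3ZdLatticeProfileSums.supNorm_le_add_sub u (u - unitVec ν)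
    rw [show u - (u - unitVec ν) = unitVec ν by abel, h1] at h
    exact_mod_cast h

/-- kernel: an exponential law survives a unit shift at the price `e^{c}`: `e^{−c|u ± e|} ≤ e^{c}·e^{−c|u|}` (`0 ≤ c`).
[cite: Balaban1983Higgs3, (3.15) p.437] -/
theorem exp_shift_le {c : ℝ} (hc : 0 ≤ c) (u : ZSite 3) (ν : Fin 3) :
    Real.exp (-(c * (supNorm (u + unitVec ν) : ℝ))) ≤ Real.exp c * Real.exp (-(c * (supNorm u : ℝ))) ∧
      Real.exp (-(c * (supNorm (u - unitVec ν) : ℝ))) ≤ Real.exp c * Real.exp (-(c * (supNorm u : ℝ))) := by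
  obtain ⟨h1, h2⟩ := supNorm_le_shift_add_one u ν
  constructor
  · rw [← Real.exp_add]
    exact Real.exp_le_exp.2 (by nlinarith)
  · rw [← Real.exp_add]
    exact Real.exp_le_exp.2 (by nlinarith)

/-- kernel: the second-difference kernel of an exponentially decaying kernel decays exponentially:
`|K(p,q)| ≤ A·e^{−c|p−q|_∞}` for all `p, q` ⇒ `|Σ_ν(∂_νK∂^*_ν)(y,y′)| ≤ 12·ξ^{−2}·A·e^{c}·e^{−c|y−y′|_∞}`.
[cite: Balaban1983Higgs3, (3.15) p.437] -/
theorem abs_d2diag_le_of_exp {ξ c A : ℝ} (hc : 0 ≤ c) {K : ZSite 3 → ZSite 3 → ℝ}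
    (hK : ∀ p q, |K p q| ≤ A * Real.exp (-(c * (supNorm (p - q) : ℝ)))) (y y' : ZSite 3) :
    |d2diag ξ K y y'| ≤ 12 * (ξ ^ 2)⁻¹ * A * Real.exp c * Real.exp (-(c * (supNorm (y - y') : ℝ))) := by
  have hA : 0 ≤ A := by
    have h := (abs_nonneg _).trans (hK y y')
    exact le_of_mul_le_mul_right (by rwa [zero_mul]) (Real.exp_pos _)
  have hec : 1 ≤ Real.exp c := Real.one_le_exp hc
  -- the four evaluations, at every pair of sites
  have hb : ∀ (ν : Fin 3) (y y' : ZSite 3), |d2K ξ ν ν K y y'| ≤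
      (ξ ^ 2)⁻¹ * (4 * (A * (Real.exp c * Real.exp (-(c * (supNorm (y - y') : ℝ)))))) := by
    intro ν y y'
    set E := Real.exp (-(c * (supNorm (y - y') : ℝ))) with hE
    have hE0 : 0 < E := Real.exp_pos _
    have e1 : y + unitVec ν - (y' + unitVec ν) = y - y' := by abel
    have e2 : y + unitVec ν - y' = y - y' + unitVec ν := by abel
    have e3 : y - (y' + unitVec ν) = y - y' - unitVec ν := by abel
    have k1 := hK (y + unitVec ν) (y' + unitVec ν)
    have k2 := hK (y + unitVec ν) y'
    have k3 := hK y (y' + unitVec ν)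
    have k4 := hK y y'
    rw [e1] at k1
    rw [e2] at k2
    rw [e3] at k3
    obtain ⟨s1, s2⟩ := exp_shift_le hc (y - y') ν
    have k1' : |K (y + unitVec ν) (y' + unitVec ν)| ≤ A * (Real.exp c * E) :=
      k1.trans (mul_le_mul_of_nonneg_left (le_mul_of_one_le_left hE0.le hec) hA)
    have k2' : |K (y + unitVec ν) y'| ≤ A * (Real.exp c * E) := k2.trans (mul_le_mul_of_nonneg_left s1 hA)
    have k3' : |K y (y' + unitVec ν)| ≤ A * (Real.exp c * E) := k3.trans (mul_le_mul_of_nonneg_left s2 hA)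
    have k4' : |K y y'| ≤ A * (Real.exp c * E) :=
      k4.trans (mul_le_mul_of_nonneg_left (le_mul_of_one_le_left hE0.le hec) hA)
    unfold d2K
    rw [abs_mul, abs_of_nonneg (by positivity : (0 : ℝ) ≤ ξ⁻¹ ^ 2), inv_pow]
    refine mul_le_mul_of_nonneg_left ?_ (by positivity)
    calc |K (y + unitVec ν) (y' + unitVec ν) - K (y + unitVec ν) y' - K y (y' + unitVec ν) + K y y'|
        ≤ |K (y + unitVec ν) (y' + unitVec ν)| + |K (y + unitVec ν) y'| + |K y (y' + unitVec ν)| + |K y y'| := by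
          have := abs_sub (K (y + unitVec ν) (y' + unitVec ν) - K (y + unitVec ν) y') (K y (y' + unitVec ν))
          have := abs_sub (K (y + unitVec ν) (y' + unitVec ν)) (K (y + unitVec ν) y')
          have := abs_add_le (K (y + unitVec ν) (y' + unitVec ν) - K (y + unitVec ν) y' - K y (y' + unitVec ν)) (K y y')
          linarith
      _ ≤ 4 * (A * (Real.exp c * E)) := by linarith
  calc |d2diag ξ K y y'| ≤ 3 * ((ξ ^ 2)⁻¹ * (4 * (A * (Real.exp c * Real.exp (-(c * (supNorm (y - y') : ℝ))))))) :=
        abs_d2diag_le_of_forall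
          (F := fun y y' => (ξ ^ 2)⁻¹ * (4 * (A * (Real.exp c * Real.exp (-(c * (supNorm (y - y') : ℝ))))))) hb y y'
    _ = 12 * (ξ ^ 2)⁻¹ * A * Real.exp c * Real.exp (-(c * (supNorm (y - y') : ℝ))) := by ring

/-- **THE (3.15)-SERIES CONVERGES FOR EXPONENTIALLY DECAYING KERNELS** (e.g. the scale pieces of (2.6), law (2.10)): if
`|K(p,q)| ≤ A·e^{−c|p−q|_∞}` and `|K′(p,q)| ≤ A′·e^{−c′|p−q|_∞}` with `c, c′ > 0`, `|g|,|g′| ≤ 1`, then `y′ ↦ term315[K,K′](y,y′)`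
(with the printed displacement) is absolutely summable — the displacement's linear growth is absorbed by `e^{−c′|y−y′|}`.
[cite: Balaban1983Higgs3, (3.15) p.437] -/
theorem summable_term315_of_exp {ξ c c' A A' : ℝ} (hξ : 0 < ξ) (hc : 0 < c) (hc' : 0 < c')
    {K K' : ZSite 3 → ZSite 3 → ℝ} (hK : ∀ p q, |K p q| ≤ A * Real.exp (-(c * (supNorm (p - q) : ℝ))))
    (hK' : ∀ p q, |K' p q| ≤ A' * Real.exp (-(c' * (supNorm (p - q) : ℝ)))) {g g' : ZSite 3 → ℝ}
    (hg : ∀ x, |g x| ≤ 1) (hg' : ∀ x, |g' x| ≤ 1) (μ : Fin 3) (y : ZSite 3) :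
    Summable (term315 ξ K K' g g' (dispZ ξ) μ y) := by
  have hA' : 0 ≤ A' := by
    have h := (abs_nonneg _).trans (hK' y y)
    exact le_of_mul_le_mul_right (by rwa [zero_mul]) (Real.exp_pos _)
  have hA : 0 ≤ A := by
    have h := (abs_nonneg _).trans (hK y y)
    exact le_of_mul_le_mul_right (by rwa [zero_mul]) (Real.exp_pos _)
  -- the dominating summable function
  set D : ℝ := 12 * (ξ ^ 2)⁻¹ * A * Real.exp c * A' * (ξ * c'⁻¹) with hD
  have hD0 : 0 ≤ D := by positivity
  obtain ⟨hsum, -, -⟩ := B3ZdLatticeProfileSums.tsum_exp_supNorm_le (d := 3) rfl hc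
  have hs0 : Summable fun y' : ZSite 3 => Real.exp (-(c * (supNorm (y - y') : ℝ))) := by
    have h := (Equiv.subLeft y).summable_iff.2 hsum
    refine h.congr fun y' => ?_
    simp only [Function.comp_apply, Equiv.subLeft_apply]
  have hs : Summable fun y' : ZSite 3 => ξ ^ 3 * (D * Real.exp (-(c * (supNorm (y - y') : ℝ)))) :=
    (hs0.mul_left D).mul_left (ξ ^ 3)
  refine Summable.of_norm_bounded hs fun y' => ?_
  rw [Real.norm_eq_abs]
  set n : ℝ := (supNorm (y - y') : ℝ) with hn
  have hd2 := abs_d2diag_le_of_exp (ξ := ξ) hc.le hK y y'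
  have hdx := abs_dispZ_le hξ.le μ y y'
  have hGy := hK' y y'
  unfold term315
  rw [abs_mul, abs_of_pos (pow_pos hξ 3), abs_mul, abs_mul, abs_mul, abs_mul]
  refine mul_le_mul_of_nonneg_left ?_ (pow_pos hξ 3).le
  -- |d2diag|·|g|·|K'|·|g'|·|dx| ≤ (12ξ⁻²Ae^c e^{-cn})·1·(A'e^{-c'n})·1·(ξn) ≤ D·e^{-cn}
  have hE : 0 ≤ 12 * (ξ ^ 2)⁻¹ * A * Real.exp c * Real.exp (-(c * n)) := by positivity
  have hE' : 0 ≤ A' * Real.exp (-(c' * n)) := by positivity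
  have h12 : |d2diag ξ K y y'| * |g y| ≤ 12 * (ξ ^ 2)⁻¹ * A * Real.exp c * Real.exp (-(c * n)) * 1 :=
    mul_le_mul hd2 (hg y) (abs_nonneg _) hE
  have h123 : |d2diag ξ K y y'| * |g y| * |K' y y'| ≤
      12 * (ξ ^ 2)⁻¹ * A * Real.exp c * Real.exp (-(c * n)) * 1 * (A' * Real.exp (-(c' * n))) :=
    mul_le_mul h12 hGy (abs_nonneg _) (by rw [mul_one]; exact hE)
  have h1234 : |d2diag ξ K y y'| * |g y| * |K' y y'| * |g' y'| ≤
      12 * (ξ ^ 2)⁻¹ * A * Real.exp c * Real.exp (-(c * n)) * 1 * (A' * Real.exp (-(c' * n))) * 1 :=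
    mul_le_mul h123 (hg' y') (abs_nonneg _) (by rw [mul_one]; exact mul_nonneg hE hE')
  have h12345 : |d2diag ξ K y y'| * |g y| * |K' y y'| * |g' y'| * |dispZ ξ μ y y'| ≤
      12 * (ξ ^ 2)⁻¹ * A * Real.exp c * Real.exp (-(c * n)) * 1 * (A' * Real.exp (-(c' * n))) * 1 * (ξ * n) :=
    mul_le_mul h1234 hdx (abs_nonneg _) (by rw [mul_one, mul_one]; exact mul_nonneg hE hE')
  have hkey : n * Real.exp (-(c' * n)) ≤ c'⁻¹ := by
    -- `x·e^{−cx} ≤ 1/c` from `x + 1 ≤ eˣ`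
    have h1 : c' * n ≤ Real.exp (c' * n) := by linarith [Real.add_one_le_exp (c' * n)]
    have hE : 0 < Real.exp (c' * n) := Real.exp_pos _
    rw [Real.exp_neg, mul_inv_le_iff₀ hE, inv_mul_eq_div, le_div_iff₀ hc']
    linarith [mul_comm n c']
  calc |d2diag ξ K y y'| * |g y| * |K' y y'| * |g' y'| * |dispZ ξ μ y y'|
      ≤ 12 * (ξ ^ 2)⁻¹ * A * Real.exp c * Real.exp (-(c * n)) * 1 * (A' * Real.exp (-(c' * n))) * 1 * (ξ * n) := h12345
    _ = 12 * (ξ ^ 2)⁻¹ * A * Real.exp c * A' * ξ * (n * Real.exp (-(c' * n))) * Real.exp (-(c * n)) := by ring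
    _ ≤ 12 * (ξ ^ 2)⁻¹ * A * Real.exp c * A' * ξ * c'⁻¹ * Real.exp (-(c * n)) := by
        have h0 : 0 ≤ 12 * (ξ ^ 2)⁻¹ * A * Real.exp c * A' * ξ := by positivity
        exact mul_le_mul_of_nonneg_right (mul_le_mul_of_nonneg_left hkey h0) (Real.exp_pos _).le
    _ = D * Real.exp (-(c * n)) := by rw [hD]; ring

variable {ℓ k : ℕ} {a m2 : ℝ}

/-- **THE SCALE PIECES `G^ξ_{(j)}(0)` OF (2.6) FOR `G_{j″}(0)` ON THE `ξ`-LATTICE** (kernels w.r.t. the volume element `ξ³`):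
`(L^{j″})³·G^η_{(j)}(0)` with p26's lattice pieces `B3Ineq210ZeroLattice.pieceLat` (matrix units) read on `ℤ³ = Fin (2+1) → ℤ`.
[cite: Balaban1983Higgs3, (2.6) p.424] -/
def pieceXi (ℓ k i : ℕ) (a m2 : ℝ) (y y' : ZSite 3) : ℝ :=
  (((ℓ : ℝ) + 1) ^ k) ^ 3 * pieceLat (d := 2) ℓ k i a m2 y y'

/-- **(2.6) FOR `G^ξ_{j″}(0)`**: `Σ_{j<j″} G^ξ_{(j)}(0) = G^ξ_{j″}(0)` as kernels on `ξℤ³` (p26's `sum_pieceLat` in the `ξ³`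
normalisation of gen 9's `GxiL`) — p. 434 *"We apply the decomposition (2.6) to the propagators G_k(0), G_k"*.
[cite: Balaban1983Higgs3, (2.6) p.424] -/
theorem sum_pieceXi (hk : 1 ≤ k) : ∑ i ∈ Finset.range k, pieceXi ℓ k i a m2 = GxiL ℓ k a m2 := by
  funext y y'
  rw [Finset.sum_apply, Finset.sum_apply]
  simp only [pieceXi]
  rw [← Finset.mul_sum, sum_pieceLat (d := 2) hk y y']
  rfl

/-- **(2.10) FOR THE `ξ`-NORMALISED PIECES AS AN EXPONENTIAL LAW ON `ℤ³`**: for `k ≥ 1`, `0 < a`, `0 ≤ m²` and every `i < k`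
there are `A, c > 0` with `|G^ξ_{(i)}(0)(p,q)| ≤ A·e^{−c|p−q|_∞}` for all `p, q` (p26's `abs_pieceLat_le`, `c = δ₁/L^i`).
[cite: Balaban1983Higgs3, (2.10) p.426] -/
theorem exists_pieceXi_exp (hℓ : 1 ≤ ℓ) (hk : 1 ≤ k) (ha : 0 < a) (hm : 0 ≤ m2) {i : ℕ} (hi : i < k) :
    ∃ A c : ℝ, 0 < c ∧ ∀ p q : ZSite 3, |pieceXi ℓ k i a m2 p q| ≤ A * Real.exp (-(c * (supNorm (p - q) : ℝ))) := by
  obtain ⟨δ₁, C, hδ₁, hC, h⟩ := abs_pieceLat_le 2 ℓ hℓ a a m2 ha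
  have hb : (0 : ℝ) < ((B4Thm110ZeroBox.bj ℓ i : ℕ) : ℝ) := by
    exact_mod_cast B4Thm110ZeroBox.bj_pos ℓ i
  refine ⟨(((ℓ : ℝ) + 1) ^ k) ^ 3 * (C * (((((B4Thm110ZeroBox.bj ℓ i : ℕ) : ℝ) ^ (2 + 1))⁻¹ *
      (B4Thm110ZeroBox.sc ℓ k i ^ 2)⁻¹))), δ₁ / ((B4Thm110ZeroBox.bj ℓ i : ℕ) : ℝ), div_pos hδ₁ hb, ?_⟩
  intro p q
  have hpq := h k hk i hi a m2 le_rfl le_rfl hm le_rfl p q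
  unfold pieceXi
  rw [abs_mul, abs_of_pos (by positivity), mul_assoc]
  refine mul_le_mul_of_nonneg_left (hpq.trans_eq ?_) (by positivity)
  rw [← B3Eq316ResolventZeroLattice.cast_supNorm_eq (p - q)]
  congr 2
  ring

/-- **(3.15) FOR THE PRINT'S PROPAGATOR = THE SUM OVER `j, j′ < j″` OF THE FIRST TERMS OF (3.11) OF THE PIECES**: with `G^ξ_{j″}(0)
= Σ_{j<j″}G^ξ_{(j)}(0)` ((2.6), `sum_pieceXi`) in BOTH slots (zero field: the vector-field piece has the same kernel), the square
bracket of (3.15) equals `Σ_{j<j″}Σ_{j′<j″}` of the brackets built from the pieces `(G^ξ_{(j)}(0), G^ξ_{(j′)}(0))` — every piece series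
converging by (2.10) (`summable_term315_of_exp`) — *"we sum with respect to j, j′ from 0 to j″ … After the summations we get
(3.15)"*, for every `k = j″ ≥ 1`, `0 < a`, `0 ≤ m²`, `|g|,|g′| ≤ 1`, `μ`, `y`. [cite: Balaban1983Higgs3, (3.15) p.437] -/
theorem bracket315L_GxiL_eq_sum_pieces (hℓ : 1 ≤ ℓ) (hk : 1 ≤ k) (ha : 0 < a) (hm : 0 ≤ m2) {g g' : ZSite 3 → ℝ}
    (hg : ∀ x, |g x| ≤ 1) (hg' : ∀ x, |g' x| ≤ 1) (μ : Fin 3) (y : ZSite 3) :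
    bracket315L (xiOf ℓ k) (GxiL ℓ k a m2) (GxiL ℓ k a m2) g g' (dispZ (xiOf ℓ k)) μ y =
      ∑ i ∈ Finset.range k, ∑ i' ∈ Finset.range k,
        bracket315L (xiOf ℓ k) (pieceXi ℓ k i a m2) (pieceXi ℓ k i' a m2) g g' (dispZ (xiOf ℓ k)) μ y := by
  rw [← sum_pieceXi (ℓ := ℓ) (a := a) (m2 := m2) hk]
  refine bracket315L_sum_sum _ _ _ _ _ _ _ _ _ _ fun i hi i' hi' => ?_
  obtain ⟨A, c, hc, hA⟩ := exists_pieceXi_exp hℓ hk ha hm (Finset.mem_range.1 hi)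
  obtain ⟨A', c', hc', hA'⟩ := exists_pieceXi_exp hℓ hk ha hm (Finset.mem_range.1 hi')
  exact summable_term315_of_exp (xiOf_pos ℓ k) hc hc' hA hA' hg hg' μ y

end Resummation

/-! ## §7 The vertex of (3.17): `|(3.15)| ≤ Cst·Σ_μΣ_x ξ³‖φ(x)‖‖q²(∂^ξ_μφ′)(x)‖` -/

section Vertex

variable {W : Type*} [NormedAddCommGroup W] [InnerProductSpace ℝ W]

/-- **THE EXPRESSION (3.15) IS A VERTEX WITH A BOUNDED COEFFICIENT** (the content of (3.17) *"of the required form (3.5)"* for the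
resummed term): if `|[bracket](μ,y)| ≤ Cst` for all `μ, y` (§4), then for every leg `φ` supported in `S`, every `D` (in (3.15):
`D_μ = ∂^ξ_μφ′`) and every charge matrix `q`, `|(3.15)| ≤ Cst·Σ_μΣ_{y∈S} ξ³‖φ(y)‖·‖q²D_μ(y)‖`. [cite: Balaban1983Higgs3, (3.17) p.437] -/
theorem abs_expr315L_le {ξ Cst : ℝ} (hξ : 0 ≤ ξ) {q : W →ₗ[ℝ] W} {G0 G : ZSite 3 → ZSite 3 → ℝ} {g g' : ZSite 3 → ℝ}
    {dx : Fin 3 → ZSite 3 → ZSite 3 → ℝ} (hb : ∀ (μ : Fin 3) (y : ZSite 3), |bracket315L ξ G0 G g g' dx μ y| ≤ Cst)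
    (S : Finset (ZSite 3)) (φ : ZSite 3 → W) (D : Fin 3 → ZSite 3 → W) :
    |expr315L ξ q G0 G g g' dx S φ D| ≤ Cst * ∑ μ : Fin 3, ∑ y ∈ S, ξ ^ 3 * (‖φ y‖ * ‖q (q (D μ y))‖) := by
  unfold expr315L
  rw [abs_neg, Finset.mul_sum]
  refine (Finset.abs_sum_le_sum_abs _ _).trans (Finset.sum_le_sum fun μ _ => ?_)
  rw [Finset.mul_sum]
  refine (Finset.abs_sum_le_sum_abs _ _).trans (Finset.sum_le_sum fun y _ => ?_)
  rw [abs_mul, abs_of_nonneg (pow_nonneg hξ 3), abs_mul]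
  have h1 := hb μ y
  have h2 := abs_real_inner_le_norm (φ y) (q (q (D μ y)))
  have hC : 0 ≤ Cst := (abs_nonneg _).trans h1
  calc ξ ^ 3 * (|bracket315L ξ G0 G g g' dx μ y| * |⟪φ y, q (q (D μ y))⟫|)
      ≤ ξ ^ 3 * (Cst * (‖φ y‖ * ‖q (q (D μ y))‖)) :=
        mul_le_mul_of_nonneg_left (mul_le_mul h1 h2 (abs_nonneg _) hC) (pow_nonneg hξ 3)
    _ = Cst * (ξ ^ 3 * (‖φ y‖ * ‖q (q (D μ y))‖)) := by ring

/-- **(3.15)/(3.17) FOR THE PRINT'S PROPAGATOR, END OF THE p. 437 ANALYSIS**: there is `Cst` (on `L` and the window only) such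
that for every `k = j″ ≥ 1`, window point, localizations `|g|,|g′| ≤ 1`, finite support `S`, leg `φ`, `D` and `q`:
`|(3.15)[G^ξ_{j″}(0), G^ξ_{j″}(0)]| ≤ Cst·Σ_μΣ_{y∈S}ξ³‖φ(y)‖‖q²D_μ(y)‖` — the resummed term of (3.17) is a local vertex with a
bounded coefficient, ON THE PRINT'S CARRIER (the zero-field infinite lattice). [cite: Balaban1983Higgs3, (3.17) p.437] -/
theorem exists_expr315L_GxiL_bound {ℓ : ℕ} (hℓ : 1 ≤ ℓ) (amin aplus m2plus : ℝ) (ha : 0 < amin) :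
    ∃ Cst : ℝ, 0 < Cst ∧ ∀ (k : ℕ), 1 ≤ k → ∀ (a m2 : ℝ), amin ≤ a → a ≤ aplus → 0 ≤ m2 → m2 ≤ m2plus →
      ∀ (g g' : ZSite 3 → ℝ), (∀ x, |g x| ≤ 1) → (∀ x, |g' x| ≤ 1) →
        ∀ (q : W →ₗ[ℝ] W) (S : Finset (ZSite 3)) (φ : ZSite 3 → W) (D : Fin 3 → ZSite 3 → W),
          |expr315L (xiOf ℓ k) q (GxiL ℓ k a m2) (GxiL ℓ k a m2) g g' (dispZ (xiOf ℓ k)) S φ D| ≤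
            Cst * ∑ μ : Fin 3, ∑ y ∈ S, (xiOf ℓ k) ^ 3 * (‖φ y‖ * ‖q (q (D μ y))‖) := by
  obtain ⟨Cst, hCst, h⟩ := exists_bracket315L_GxiL_bound hℓ amin aplus m2plus ha
  refine ⟨Cst, hCst, ?_⟩
  intro k hk a m2 ha1 ha2 hm1 hm2 g g' hg hg' q S φ D
  exact abs_expr315L_le (xiOf_pos ℓ k).le (fun μ y => (h k hk a m2 ha1 ha2 hm1 hm2 g g' hg hg' μ y).2) S φ D

end Vertex



end

end Literature.MathematicalPhysics.QuantumFieldTheory.Balaban1983to89.B3Bound316ZeroLattice
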